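import Summits.AtomisticToContinuum.Crystallization.Theorems.ThreeConeCertificateSlackRigidityPricedFloorsDefs
import Summits.AtomisticToContinuum.Crystallization.Theorems.PhononSlackCertificatesPeriodicGivenLayeredLayerCake3
import Summits.AtomisticToContinuum.Crystallization.Theorems.MinMeanCycleStackingLockLockedBoxMinimiserLayerSums
import HarnessLib

/-!
# `SlackRigidity` (stmt-AtomisticToContinuum-11960), line `priced-floors-palm-exactification`, stub S3
# (`stub_layeredMeanSelection`), analysis package: continuity of the Lennard-Jones layer energies, part 2

Lead c19, S3 analysis (C2), (C3).  On the NORMAL-FORM LAYERING DATA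
`e = (T, a, s, z) : (E3 →L[ℝ] E3) × ℝ × (ℤ → ℤ) × (ℤ → ℝ)` with `47/50 ≤ a ≤ 1`, height increments
`z (m+1) − z m ∈ [39a/50, 17a/20]` and `z 0 = 0`, the root layer-cake energy
`Φ₀(a) + Σ'_{m ≠ 0} layerInteraction lennardJones a (z m) (L m) 1` is continuous:

* `lms_continuousOn_layerEnergy_fixedLabels` (C2) — for a FIXED label sequence `L`;
* `lms_continuousOn_rootEnergyData` (C3) — for the data's own labels `L = haggLabel s`, which are
  locally constant (continuous into the discrete `ℤ`) in the word coordinates.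

Route (`continuousOn_layerEnergy_of_continuous_labels`, any label assignment continuous in the data):
the in-layer sum `Φ₀(a)` is continuous in `a` (`LockedBoxMinimiser.continuousOn_inLayerInteraction`);
each layer term is (C1) (`lms_continuousOn_layerInteraction` of part 1, restated here privately from
`LockedBoxMinimiser.continuousOn_layerInteraction` so that the two parts build independently) composed with the continuous
coordinates `e ↦ (a, z m)` — which send the data into the box `|z m| ≥ 7/10` (`cake_height_sep`) — after
freezing the label near each point; and the layer sum converges uniformly on the data by the landed decay
`|Φ(a, H, δ)| ≤ 192 / H⁴` (`cake_abs_layerInteraction_le`) with `|z m| ≥ (39/50)(47/50)|m|`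
(`cake_abs_height_diff_ge`), i.e. the summable majorant `192 / ((39/50)(47/50) m)⁴`
(`continuousOn_tsum`).  All `[folklore]`.
-/

noncomputable section

open Filter Set Topology
open scoped BigOperators

namespace Summit.AtomisticToContinuum.Crystallization.Theorems.SlackRigidityPricedFloorsContinuity

open Literature.MathematicalPhysics.StatisticalMechanics
open Summit.AtomisticToContinuum.Crystallization.Theorems.SlackRigidityPricedFloors
open Summit.AtomisticToContinuum.Crystallization.Theorems.LayeredHull

/-! ## The layer interaction on the box (part 1, restated privately to decouple the build) -/

/-- The layer interaction at height `|h|` is the one at height `h` (reflection in the layer plane;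
`SlackRigidityPricedFloorsContinuity.layerInteraction_abs_height` of part 1). [folklore] -/
private theorem layerInteraction_abs_height' (V : ℝ → ℝ) (a h : ℝ) (δ k : ℤ) :
    layerInteraction V a |h| δ k = layerInteraction V a h δ k := by
  rcases abs_choice h with h' | h' <;> rw [h']
  unfold layerInteraction
  refine tsum_congr fun ij => ?_
  rw [norm_layerVec, norm_layerVec]
  congr 2
  ring

/-- (C1) of part 1 (`lms_continuousOn_layerInteraction`), restated: `(a, H) ↦ Φ(a, H, δ)` is continuous
on the box `{47/50 ≤ a ≤ 1, 7/10 ≤ |H|}`. [folklore] -/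
private theorem continuousOn_layerInteraction_box (δ : ℤ) :
    ContinuousOn (fun p : ℝ × ℝ => layerInteraction lennardJones p.1 p.2 δ 1)
      {p | 47 / 50 ≤ p.1 ∧ p.1 ≤ 1 ∧ 7 / 10 ≤ |p.2|} := by
  have hg := LockedBoxMinimiser.continuousOn_layerInteraction (a₁ := 47 / 50) (h₁ := 7 / 10)
    (by norm_num) (by norm_num) δ (k := 1) one_ne_zero
  have hφ : Continuous fun p : ℝ × ℝ => (p.1, |p.2|) := by fun_prop
  refine (hg.comp hφ.continuousOn fun p hp => ⟨hp.1, hp.2.2⟩).congr fun p _ => ?_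
  simp only [Function.comp_apply]
  exact (layerInteraction_abs_height' lennardJones p.1 p.2 δ 1).symm

/-! ## The uniform majorant of the layer interactions over the normal-form data -/

/-- Decay of the layer interactions seen from the root layer, uniformly over the normal-form data and
the letter offsets: `|Φ(a, z m, δ)| ≤ 192 / ((39/50)(47/50) m)⁴` for `m ≠ 0`. [folklore] -/
theorem abs_layerInteraction_le_majorant {a : ℝ} {z : ℤ → ℝ} (ha : 47 / 50 ≤ a) (ha1 : a ≤ 1)
    (hz : ∀ m : ℤ, 39 / 50 * a ≤ z (m + 1) - z m) (hz0 : z 0 = 0) {m : ℤ} (hm : m ≠ 0) (δ : ℤ) :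
    |layerInteraction lennardJones a (z m) δ 1| ≤ 192 / (39 / 50 * (47 / 50) * (m : ℝ)) ^ 4 := by
  have hsep : 7 / 10 ≤ |z m| := by simpa [hz0] using cake_height_sep a ha z hz hm
  have h1 := cake_abs_layerInteraction_le a (z m) ha ha1 hsep δ
  have h2 : 39 / 50 * (47 / 50) * |(m : ℝ)| ≤ |z m| := by
    have h := cake_abs_height_diff_ge a (by linarith) z hz 0 m
    simp only [Int.cast_zero, sub_zero, hz0] at h
    nlinarith [abs_nonneg (m : ℝ)]
  have hm' : (0 : ℝ) < |(m : ℝ)| := abs_pos.2 (by exact_mod_cast hm)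
  have hpos : 0 < 39 / 50 * (47 / 50) * |(m : ℝ)| := by positivity
  have h4 : ∀ x : ℝ, x ^ 4 = |x| ^ 4 := fun x => (Even.pow_abs ⟨2, rfl⟩ x).symm
  calc |layerInteraction lennardJones a (z m) δ 1| ≤ 192 / (z m) ^ 4 := h1
    _ ≤ 192 / (39 / 50 * (47 / 50) * (m : ℝ)) ^ 4 := by
        rw [h4 (z m), h4 (39 / 50 * (47 / 50) * (m : ℝ)), abs_mul,
          abs_of_pos (by norm_num : (0 : ℝ) < 39 / 50 * (47 / 50))]
        exact div_le_div_of_nonneg_left (by norm_num) (pow_pos hpos 4) (pow_le_pow_left₀ hpos.le h2 4)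

/-- The majorant `m ↦ 192 / ((39/50)(47/50) m)⁴` (value `0` at `m = 0`) is summable over `ℤ`.
[folklore] -/
theorem summable_majorant :
    Summable fun m : ℤ => if m = 0 then (0 : ℝ) else 192 / (39 / 50 * (47 / 50) * (m : ℝ)) ^ 4 := by
  refine cake_summable_of_layer_bound (47 / 50) le_rfl (fun m => 39 / 50 * (47 / 50) * (m : ℝ))
    (fun m => ?_) 0 _ (fun m hm => ?_)
  · push_cast
    linarith
  · rw [if_neg hm, abs_of_nonneg (by positivity)]
    simp

/-! ## Layer terms with locally constant labels -/

/-- The coordinates `e ↦ (a, z m)` map the normal-form data into the box of (C1) when `m ≠ 0`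
(`|z m| = |z m − z 0| ≥ 7/10`, `cake_height_sep`). [folklore] -/
theorem mapsTo_coords {m : ℤ} (hm : m ≠ 0) :
    Set.MapsTo (fun e : (E3 →L[ℝ] E3) × ℝ × (ℤ → ℤ) × (ℤ → ℝ) => (e.2.1, e.2.2.2 m))
      {e | 47 / 50 ≤ e.2.1 ∧ e.2.1 ≤ 1 ∧ (∀ m : ℤ, 39 / 50 * e.2.1 ≤ e.2.2.2 (m + 1) - e.2.2.2 m ∧
        e.2.2.2 (m + 1) - e.2.2.2 m ≤ 17 / 20 * e.2.1) ∧ e.2.2.2 0 = 0}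
      {p : ℝ × ℝ | 47 / 50 ≤ p.1 ∧ p.1 ≤ 1 ∧ 7 / 10 ≤ |p.2|} := by
  intro e he
  refine ⟨he.1, he.2.1, ?_⟩
  simpa [he.2.2.2] using cake_height_sep e.2.1 he.1 e.2.2.2 (fun k => (he.2.2.1 k).1) hm

/-- A layer term with a FIXED letter offset `L`, `e ↦ Φ(a, z m, L)`, is continuous on the normal-form
data for `m ≠ 0` ((C1) composed with the continuous coordinates `e ↦ (a, z m)`). [folklore] -/
theorem continuousOn_layerTerm_fixed (L : ℤ) {m : ℤ} (hm : m ≠ 0) :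
    ContinuousOn (fun e : (E3 →L[ℝ] E3) × ℝ × (ℤ → ℤ) × (ℤ → ℝ) =>
        layerInteraction lennardJones e.2.1 (e.2.2.2 m) L 1)
      {e | 47 / 50 ≤ e.2.1 ∧ e.2.1 ≤ 1 ∧ (∀ m : ℤ, 39 / 50 * e.2.1 ≤ e.2.2.2 (m + 1) - e.2.2.2 m ∧
        e.2.2.2 (m + 1) - e.2.2.2 m ≤ 17 / 20 * e.2.1) ∧ e.2.2.2 0 = 0} := by
  have hφ : Continuous fun e : (E3 →L[ℝ] E3) × ℝ × (ℤ → ℤ) × (ℤ → ℝ) => (e.2.1, e.2.2.2 m) := by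
    fun_prop
  have hcomp := (continuousOn_layerInteraction_box L).comp hφ.continuousOn (mapsTo_coords hm)
  exact hcomp

/-- A layer term `e ↦ Φ(a, z m, Λ e m)` whose letter offset is a CONTINUOUS (= locally constant)
integer-valued function `Λ · m` of the data is continuous on the normal-form data (`m ≠ 0`): near
each point the label is frozen and the frozen term is `continuousOn_layerTerm_fixed`. [folklore] -/
theorem continuousOn_layerTerm (Λ : (E3 →L[ℝ] E3) × ℝ × (ℤ → ℤ) × (ℤ → ℝ) → ℤ → ℤ)
    (hΛ : ∀ m : ℤ, Continuous fun e => Λ e m) {m : ℤ} (hm : m ≠ 0) :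
    ContinuousOn (fun e : (E3 →L[ℝ] E3) × ℝ × (ℤ → ℤ) × (ℤ → ℝ) =>
        layerInteraction lennardJones e.2.1 (e.2.2.2 m) (Λ e m) 1)
      {e | 47 / 50 ≤ e.2.1 ∧ e.2.1 ≤ 1 ∧ (∀ m : ℤ, 39 / 50 * e.2.1 ≤ e.2.2.2 (m + 1) - e.2.2.2 m ∧
        e.2.2.2 (m + 1) - e.2.2.2 m ≤ 17 / 20 * e.2.1) ∧ e.2.2.2 0 = 0} := by
  intro e₀ he₀
  have hopen : IsOpen ((fun e => Λ e m) ⁻¹' {Λ e₀ m}) :=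
    (hΛ m).isOpen_preimage _ (isOpen_discrete {Λ e₀ m})
  have hev : ∀ᶠ e in 𝓝 e₀, Λ e m = Λ e₀ m := hopen.mem_nhds (Set.mem_singleton _)
  have hfix := continuousOn_layerTerm_fixed (Λ e₀ m) hm e₀ he₀
  refine hfix.congr_of_eventuallyEq ((hev.filter_mono nhdsWithin_le_nhds).mono fun e he => ?_) rfl
  simp only [he]

/-- The in-layer energy `e ↦ Φ₀(a)` is continuous on the normal-form data
(`LockedBoxMinimiser.continuousOn_inLayerInteraction` composed with `e ↦ (a, 1)`). [folklore] -/
theorem continuousOn_inLayerTerm :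
    ContinuousOn (fun e : (E3 →L[ℝ] E3) × ℝ × (ℤ → ℤ) × (ℤ → ℝ) => inLayerInteraction lennardJones e.2.1)
      {e | 47 / 50 ≤ e.2.1 ∧ e.2.1 ≤ 1 ∧ (∀ m : ℤ, 39 / 50 * e.2.1 ≤ e.2.2.2 (m + 1) - e.2.2.2 m ∧
        e.2.2.2 (m + 1) - e.2.2.2 m ≤ 17 / 20 * e.2.1) ∧ e.2.2.2 0 = 0} := by
  have hg := LockedBoxMinimiser.continuousOn_inLayerInteraction (a₁ := 47 / 50) (h₁ := 7 / 10)
    (by norm_num) (by norm_num)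
  have hφ : Continuous fun e : (E3 →L[ℝ] E3) × ℝ × (ℤ → ℤ) × (ℤ → ℝ) => (e.2.1, (1 : ℝ)) := by
    fun_prop
  have hmaps : Set.MapsTo (fun e : (E3 →L[ℝ] E3) × ℝ × (ℤ → ℤ) × (ℤ → ℝ) => (e.2.1, (1 : ℝ)))
      {e | 47 / 50 ≤ e.2.1 ∧ e.2.1 ≤ 1 ∧ (∀ m : ℤ, 39 / 50 * e.2.1 ≤ e.2.2.2 (m + 1) - e.2.2.2 m ∧
        e.2.2.2 (m + 1) - e.2.2.2 m ≤ 17 / 20 * e.2.1) ∧ e.2.2.2 0 = 0}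
      (Set.Ici (47 / 50) ×ˢ Set.Ici (7 / 10)) := by
    intro e he
    exact ⟨Set.mem_Ici.2 he.1, Set.mem_Ici.2 (by norm_num)⟩
  have hcomp := hg.comp hφ.continuousOn hmaps
  exact hcomp

/-- **The root layer-cake energy with continuous labels is continuous on the normal-form data.**
For any label assignment `Λ` that is a continuous (locally constant) function of the data,
`e ↦ Φ₀(a) + Σ'_{m ≠ 0} Φ(a, z m, Λ e m)` is continuous on the normal-form data: the in-layer sum is
`continuousOn_inLayerTerm`, and the layer sum is a uniformly convergent sum (`continuousOn_tsum`,
majorant `192 / ((39/50)(47/50) m)⁴`) of terms that are continuous by `continuousOn_layerTerm`.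
[folklore] -/
theorem continuousOn_layerEnergy_of_continuous_labels
    (Λ : (E3 →L[ℝ] E3) × ℝ × (ℤ → ℤ) × (ℤ → ℝ) → ℤ → ℤ) (hΛ : ∀ m : ℤ, Continuous fun e => Λ e m) :
    ContinuousOn (fun e : (E3 →L[ℝ] E3) × ℝ × (ℤ → ℤ) × (ℤ → ℝ) => inLayerInteraction lennardJones e.2.1 +
        ∑' m : ℤ, if m = 0 then (0 : ℝ) else layerInteraction lennardJones e.2.1 (e.2.2.2 m) (Λ e m) 1)
      {e | 47 / 50 ≤ e.2.1 ∧ e.2.1 ≤ 1 ∧ (∀ m : ℤ, 39 / 50 * e.2.1 ≤ e.2.2.2 (m + 1) - e.2.2.2 m ∧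
        e.2.2.2 (m + 1) - e.2.2.2 m ≤ 17 / 20 * e.2.1) ∧ e.2.2.2 0 = 0} := by
  refine continuousOn_inLayerTerm.add (continuousOn_tsum (fun m => ?_) summable_majorant fun m e he => ?_)
  · by_cases hm : m = 0
    · simp only [hm, if_true]
      exact continuousOn_const
    · simp only [hm, if_false]
      exact continuousOn_layerTerm Λ hΛ hm
  · by_cases hm : m = 0
    · simp [hm]
    · simp only [hm, if_false, Real.norm_eq_abs]
      exact abs_layerInteraction_le_majorant he.1 he.2.1 (fun k => (he.2.2.1 k).1) he.2.2.2 hm _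

/-! ## (C2) Fixed labels -/

/-- **(C2), registered sub-goal `lms_continuousOn_layerEnergy_fixedLabels`.** With a FIXED label
sequence `L`, the root layer-cake energy `e ↦ Φ₀(a) + Σ'_{m ≠ 0} Φ(a, z m, L m)` is continuous on the
normal-form data. [folklore] -/
theorem lms_continuousOn_layerEnergy_fixedLabels : ∀ (L : ℤ → ℤ), ContinuousOn (fun e : (E3 →L[ℝ] E3) × ℝ × (ℤ → ℤ) × (ℤ → ℝ) => inLayerInteraction lennardJones e.2.1 + ∑' m : ℤ, if m = 0 then (0 : ℝ) else layerInteraction lennardJones e.2.1 (e.2.2.2 m) (L m) 1) {e | 47 / 50 ≤ e.2.1 ∧ e.2.1 ≤ 1 ∧ (∀ m : ℤ, 39 / 50 * e.2.1 ≤ e.2.2.2 (m + 1) - e.2.2.2 m ∧ e.2.2.2 (m + 1) - e.2.2.2 m ≤ 17 / 20 * e.2.1) ∧ e.2.2.2 0 = 0} :=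
  fun L => continuousOn_layerEnergy_of_continuous_labels (fun _ m => L m) fun _ => continuous_const

/-! ## (C3) The data's own labels -/

/-- The stacking labels `s ↦ haggLabel s m` are continuous on the word space `ℤ → ℤ` (finite window
sums of coordinates). [folklore] -/
theorem continuous_haggLabel (m : ℤ) : Continuous fun s : ℤ → ℤ => haggLabel s m := by
  have hw : ∀ (m₀ : ℤ) (k : ℕ), Continuous fun s : ℤ → ℤ => haggWindow s m₀ k := fun m₀ k => by
    unfold haggWindow
    exact continuous_finsetSum _ fun i _ => continuous_apply (m₀ + (i : ℤ))
  by_cases h : 0 ≤ m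
  · simp only [haggLabel, h, if_true]
    exact hw 0 _
  · simp only [haggLabel, h, if_false]
    exact (hw m _).neg

/-- The data's labels `e ↦ haggLabel e.2.2.1 m` are continuous on the data space. [folklore] -/
theorem continuous_haggLabel_data (m : ℤ) :
    Continuous fun e : (E3 →L[ℝ] E3) × ℝ × (ℤ → ℤ) × (ℤ → ℝ) => haggLabel e.2.2.1 m :=
  (continuous_haggLabel m).comp (continuous_fst.comp (continuous_snd.comp continuous_snd))

/-- **(C3), registered sub-goal `lms_continuousOn_rootEnergyData`.** With the data's own labels
`haggLabel s m` (locally constant in the discrete word coordinates), the root layer-cake energy is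
continuous on the normal-form data. [folklore] -/
theorem lms_continuousOn_rootEnergyData : ContinuousOn (fun e : (E3 →L[ℝ] E3) × ℝ × (ℤ → ℤ) × (ℤ → ℝ) => inLayerInteraction lennardJones e.2.1 + ∑' m : ℤ, if m = 0 then (0 : ℝ) else layerInteraction lennardJones e.2.1 (e.2.2.2 m) (haggLabel e.2.2.1 m) 1) {e | 47 / 50 ≤ e.2.1 ∧ e.2.1 ≤ 1 ∧ (∀ m : ℤ, 39 / 50 * e.2.1 ≤ e.2.2.2 (m + 1) - e.2.2.2 m ∧ e.2.2.2 (m + 1) - e.2.2.2 m ≤ 17 / 20 * e.2.1) ∧ e.2.2.2 0 = 0} :=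
  continuousOn_layerEnergy_of_continuous_labels (fun e m => haggLabel e.2.2.1 m) continuous_haggLabel_data

end Summit.AtomisticToContinuum.Crystallization.Theorems.SlackRigidityPricedFloorsContinuity

end
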